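import Summits.HodgeConjecture.HodgeConjecture.Theses.AnchorTransport
import Summits.HodgeConjecture.HodgeConjecture.Theorems.AnchorTransportIsoInvariance
import Literature.AlgebraicGeometry.HodgeTheory.FermatHypersurfaceReduction
import Literature.AlgebraicGeometry.HodgeTheory.MotivatedClassesDeformation

/-!
# Route AnchorTransport — `AnchorExistence` (item stmt-HodgeConjecture-1077): floors and base change

Two composition lemmas every "anchor" line uses, on the verbatim `∃`-shape of the crux
`AnchorExistence`:

* `anchorTransport_anchor_of_floor` — **anchoring at a FLOOR where the Hodge conjecture is known**:
  a smooth projective family `f : 𝒳 ⟶ S` over a smooth irreducible base, points `s₁, s₀`,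
  `e : X ≅ 𝒳_{s₁}`, a global class `A` fibrewise rational of type `(p,p)` with `e^*(A|_{𝒳_{s₁}}) = c`,
  and an isomorphism `g : 𝒳_{s₀} ≅ X₀` onto a `ℂ`-scheme `X₀` on which every rational `(p,p)`-class in
  `H²ᵖ` is algebraic (a "floor": Fermat standard model, an abelian variety in a proved Weil/CM range,
  a variety of dimension `≤ 3`, …) give the anchoring datum for `(X, c)`: `(g⁻¹)^*(A|_{𝒳_{s₀}})` is
  rational and of type `(p,p)` on `X₀` (`IsRationalClass.map`, `IsOfHodgeType.map_of_iso`), hence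
  algebraic there, and algebraicity comes back along `g` (the route's proved `IsoInvariance`).
* `anchorTransport_anchor_baseChange` — **anchoring data are stable under base change** along any
  `g : S' ⟶ S` with `S'` smooth irreducible: the base-changed family `𝒳 ×_S S' ⟶ S'`
  (`Motives.familyPullback.snd`, smooth projective by `IsSmoothProjectiveFamily.familyPullback_snd`)
  with the pulled-back class `pr₁^* A` anchors `(X, c)` at points `s₁', s₀'` over `s₁ = g(s₁')`,
  `s₀ = g(s₀')`, through the fibre identifications `(𝒳 ×_S S')_{s'} ≅ 𝒳_{g(s')}`
  (`Motives.fiberOverFamilyPullbackIso`, compatible with the fibre inclusions). This is the formal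
  shape of "after a finite étale base change making the flat section invariant".
-/

noncomputable section

set_option linter.dupNamespace false

open CategoryTheory AlgebraicGeometry
open Literature.AlgebraicGeometry Literature.AlgebraicGeometry.Motives
  Literature.AlgebraicGeometry.HodgeTheory Literature.AlgebraicTopology.SingularHomology

namespace Summit.HodgeConjecture.HodgeConjecture.Theorems

open Summit.HodgeConjecture.HodgeConjecture.Theses.AnchorTransport

/-! ### Anchoring at a floor where the Hodge conjecture is known -/

/-- **Anchoring at a floor.** Let `f : 𝒳 ⟶ S` be a smooth projective family of relative dimension `n`
over a smooth irreducible `ℂ`-scheme, `A ∈ H²ᵖ(𝒳(ℂ); ℂ)` fibrewise rational of type `(p,p)`,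
`e : X ≅ 𝒳_{s₁}` with `e^*(A|_{𝒳_{s₁}}) = c`, and `g : 𝒳_{s₀} ≅ X₀` an isomorphism of the anchor fibre
with a `ℂ`-scheme `X₀` on which every rational `(p,p)`-class in `H²ᵖ(X₀(ℂ); ℂ)` (Hodge type computed in
dimension `n`) is algebraic. Then `(f, s₁, s₀, e, A)` is an anchoring datum for `(X, c)` in the sense
of `AnchorExistence`: `(g⁻¹)^*(A|_{𝒳_{s₀}})` is rational (`IsRationalClass.map`) and of type `(p,p)`
(`IsOfHodgeType.map_of_iso`), hence algebraic on `X₀`, and `A|_{𝒳_{s₀}} = g^*(g⁻¹)^*(A|_{𝒳_{s₀}})` is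
algebraic by the route's proved `IsoInvariance`. [cite: Fulton1998, §19.1] [cite: VoisinHodgeI2002, §7.3.2] -/
theorem anchorTransport_anchor_of_floor {n p : ℕ} {X X₀ 𝒳 S : SchemeOver ℂ} (f : 𝒳 ⟶ S)
    (s₁ s₀ : ComplexPoints S) (e : X ≅ fiberOver f s₁) (A : complexBetti 𝒳 (2 * p))
    (hf : IsSmoothProjectiveFamily f n) (hirr : IrreducibleSpace S.left)
    (hsm : AlgebraicGeometry.Smooth S.hom)
    (hfib : ∀ s : ComplexPoints S, IsRationalClass (complexBetti.map (fiberι f s) (2 * p) A) ∧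
      IsOfHodgeType n (fiberOver f s) (2 * p) p p (complexBetti.map (fiberι f s) (2 * p) A))
    {c : complexBetti X (2 * p)}
    (hAc : complexBetti.map e.hom (2 * p) (complexBetti.map (fiberι f s₁) (2 * p) A) = c)
    (g : fiberOver f s₀ ≅ X₀)
    (hX₀ : ∀ c₀ : complexBetti X₀ (2 * p), IsRationalClass c₀ → IsOfHodgeType n X₀ (2 * p) p p c₀ →
      c₀ ∈ algebraicClasses X₀ p) :
    ∃ (𝒳 S : SchemeOver ℂ) (f : 𝒳 ⟶ S) (s₁ s₀ : ComplexPoints S) (e : X ≅ fiberOver f s₁)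
      (A : complexBetti 𝒳 (2 * p)),
      IsSmoothProjectiveFamily f n ∧ IrreducibleSpace S.left ∧ AlgebraicGeometry.Smooth S.hom ∧
      (∀ s : ComplexPoints S, IsRationalClass (complexBetti.map (fiberι f s) (2 * p) A) ∧
        IsOfHodgeType n (fiberOver f s) (2 * p) p p (complexBetti.map (fiberι f s) (2 * p) A)) ∧
      complexBetti.map e.hom (2 * p) (complexBetti.map (fiberι f s₁) (2 * p) A) = c ∧
      complexBetti.map (fiberι f s₀) (2 * p) A ∈ algebraicClasses (fiberOver f s₀) p := by
  refine ⟨𝒳, S, f, s₁, s₀, e, A, hf, hirr, hsm, hfib, hAc, ?_⟩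
  -- the anchor class read on the floor `X₀`
  have h₀ : complexBetti.map g.inv (2 * p) (complexBetti.map (fiberι f s₀) (2 * p) A) ∈
      algebraicClasses X₀ p :=
    hX₀ _ ((hfib s₀).1.map _) ((hfib s₀).2.map_of_iso g.symm)
  -- … and brought back along `g`
  have h₁ := anchorTransport_isoInvariance_proof g p _ h₀
  have hid : complexBetti.map g.hom (2 * p)
      (complexBetti.map g.inv (2 * p) (complexBetti.map (fiberι f s₀) (2 * p) A)) =
        complexBetti.map (fiberι f s₀) (2 * p) A := by
    change (complexBetti.map g.inv (2 * p) ≫ complexBetti.map g.hom (2 * p)) _ = _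
    rw [← complexBetti.map_comp, Iso.hom_inv_id, complexBetti.map_id]
    rfl
  rwa [hid] at h₁

/-! ### Base change of anchoring data -/

/-- The fibre restriction of the pulled-back class on a base change is the fibre restriction of the
original class, read through `(𝒳 ×_S S')_{s'} ≅ 𝒳_{g(s')}`:
`(pr₁^* A)|_{(𝒳 ×_S S')_{s'}} = ι^*(A|_{𝒳_{g(s')}})` for `ι = fiberOverFamilyPullbackIso f g s'`
(both are the pull-back of `A` along `(𝒳 ×_S S')_{s'} ⟶ 𝒳 ×_S S' ⟶ 𝒳`,
`fiberOverFamilyPullbackIso_hom_fiberι`). [cite: Hartshorne1977, II.3 p. 89] -/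
theorem anchorTransport_map_fiberι_familyPullback {p : ℕ} {𝒳 S S' : SchemeOver ℂ} (f : 𝒳 ⟶ S)
    (g : S' ⟶ S) (A : complexBetti 𝒳 (2 * p)) (s' : ComplexPoints S') :
    complexBetti.map (fiberι (familyPullback.snd f g) s') (2 * p)
        (complexBetti.map (familyPullback.fst f g) (2 * p) A) =
      complexBetti.map (fiberOverFamilyPullbackIso f g s').hom (2 * p)
        (complexBetti.map (fiberι f (AlgPoints.map g s')) (2 * p) A) := by
  change (complexBetti.map (familyPullback.fst f g) (2 * p) ≫
      complexBetti.map (fiberι (familyPullback.snd f g) s') (2 * p)) A =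
    (complexBetti.map (fiberι f (AlgPoints.map g s')) (2 * p) ≫
      complexBetti.map (fiberOverFamilyPullbackIso f g s').hom (2 * p)) A
  rw [← complexBetti.map_comp, ← complexBetti.map_comp, fiberOverFamilyPullbackIso_hom_fiberι]

/-- **Anchoring data are stable under base change.** Let `f : 𝒳 ⟶ S` be a smooth projective family
of relative dimension `n`, `A ∈ H²ᵖ(𝒳(ℂ); ℂ)` fibrewise rational of type `(p,p)`, and `g : S' ⟶ S`
a morphism from a smooth irreducible `ℂ`-scheme `S'` with points `s₁', s₀' ∈ S'(ℂ)`. If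
`e : X ≅ 𝒳_{g(s₁')}` carries `A|_{𝒳_{g(s₁')}}` to `c` and `A|_{𝒳_{g(s₀')}}` is algebraic, then the
base-changed family `𝒳 ×_S S' ⟶ S'` (smooth projective: `IsSmoothProjectiveFamily.familyPullback_snd`)
with the class `pr₁^* A`, the points `s₁', s₀'` and `e ≫ ι⁻¹` (`ι : (𝒳 ×_S S')_{s₁'} ≅ 𝒳_{g(s₁')}`,
`fiberOverFamilyPullbackIso`) is an anchoring datum for `(X, c)` in the sense of `AnchorExistence`:
fibre restrictions of `pr₁^* A` are the `ι^*` of those of `A` (`anchorTransport_map_fiberι_familyPullback`),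
so rationality, Hodge type (`IsOfHodgeType.map_of_iso`) and algebraicity (`IsoInvariance`) transfer.
[cite: Hartshorne1977, II.3 p. 89] [cite: VoisinHodgeI2002, §7.3.2] -/
theorem anchorTransport_anchor_baseChange {n p : ℕ} {X 𝒳 S S' : SchemeOver ℂ} (f : 𝒳 ⟶ S)
    (g : S' ⟶ S) (s₁' s₀' : ComplexPoints S') (e : X ≅ fiberOver f (AlgPoints.map g s₁'))
    (A : complexBetti 𝒳 (2 * p)) (hf : IsSmoothProjectiveFamily f n)
    (hirr : IrreducibleSpace S'.left) (hsm : AlgebraicGeometry.Smooth S'.hom)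
    (hfib : ∀ s : ComplexPoints S, IsRationalClass (complexBetti.map (fiberι f s) (2 * p) A) ∧
      IsOfHodgeType n (fiberOver f s) (2 * p) p p (complexBetti.map (fiberι f s) (2 * p) A))
    {c : complexBetti X (2 * p)}
    (hAc : complexBetti.map e.hom (2 * p)
      (complexBetti.map (fiberι f (AlgPoints.map g s₁')) (2 * p) A) = c)
    (hs₀ : complexBetti.map (fiberι f (AlgPoints.map g s₀')) (2 * p) A ∈
      algebraicClasses (fiberOver f (AlgPoints.map g s₀')) p) :
    ∃ (𝒳 S : SchemeOver ℂ) (f : 𝒳 ⟶ S) (s₁ s₀ : ComplexPoints S) (e : X ≅ fiberOver f s₁)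
      (A : complexBetti 𝒳 (2 * p)),
      IsSmoothProjectiveFamily f n ∧ IrreducibleSpace S.left ∧ AlgebraicGeometry.Smooth S.hom ∧
      (∀ s : ComplexPoints S, IsRationalClass (complexBetti.map (fiberι f s) (2 * p) A) ∧
        IsOfHodgeType n (fiberOver f s) (2 * p) p p (complexBetti.map (fiberι f s) (2 * p) A)) ∧
      complexBetti.map e.hom (2 * p) (complexBetti.map (fiberι f s₁) (2 * p) A) = c ∧
      complexBetti.map (fiberι f s₀) (2 * p) A ∈ algebraicClasses (fiberOver f s₀) p := by
  refine ⟨familyPullback f g, S', familyPullback.snd f g, s₁', s₀',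
    e ≪≫ (fiberOverFamilyPullbackIso f g s₁').symm,
    complexBetti.map (familyPullback.fst f g) (2 * p) A, hf.familyPullback_snd g, hirr, hsm,
    fun s' => ?_, ?_, ?_⟩
  · -- fibrewise rational and of type `(p,p)`
    rw [anchorTransport_map_fiberι_familyPullback]
    exact ⟨(hfib _).1.map _, (hfib _).2.map_of_iso (fiberOverFamilyPullbackIso f g s')⟩
  · -- `(e ≫ ι⁻¹)^* ((pr₁^* A)|_{s₁'}) = e^* (ι⁻¹)^* ι^* (A|_{g(s₁')}) = e^*(A|_{g(s₁')}) = c`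
    rw [anchorTransport_map_fiberι_familyPullback, ← hAc, Iso.trans_hom, Iso.symm_hom,
      complexBetti.map_comp]
    change complexBetti.map e.hom (2 * p)
        ((complexBetti.map (fiberOverFamilyPullbackIso f g s₁').hom (2 * p) ≫
          complexBetti.map (fiberOverFamilyPullbackIso f g s₁').inv (2 * p))
          (complexBetti.map (fiberι f (AlgPoints.map g s₁')) (2 * p) A)) = _
    rw [← complexBetti.map_comp, Iso.inv_hom_id, complexBetti.map_id]
    rfl
  · -- algebraic at `s₀'`
    rw [anchorTransport_map_fiberι_familyPullback]
    exact anchorTransport_isoInvariance_proof (fiberOverFamilyPullbackIso f g s₀') p _ hs₀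

end Summit.HodgeConjecture.HodgeConjecture.Theorems

end
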